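import Literature.AlgebraicGeometry.HodgeTheory.LefschetzOneOneHolds
import Literature.AlgebraicGeometry.HodgeTheory.AbelianLowDimensionHodgeConjecture
import Literature.Barriers.HodgeConjecture.DecompositionOfTheDiagonal

/-!
# `MiddleHodgeLadder` — WITNESS file (F3 / BC5) for crux `HodgeBeyondAnchors` (stmt-HodgeConjecture-14054)

Self-contained (imports Literature only): the rung family `MiddleHodge m` of `Lines/MiddleHodgeLadder.lean`
restated verbatim, and the PROVED rungs:

* `rung_zero`, `rung_one` — the FLOOR `θ₀ = 1`: Lefschetz's theorem on `(1,1)`-classes (tree theorem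
  `lefschetzOneOne_rational_holds`, VoisinHodgeI2002 Thm 11.30).  `example : MiddleHodge 1`.
* `dims_le_three` — the same floor in the dimension parameter: `HodgeConjectureFor n X` for `n ≤ 3`
  (tree theorem `hodgeConjectureFor_of_dim_le_three_holds`: Lefschetz `(1,1)` + hard Lefschetz).
* `rung_two_of_chowZeroSupported` — a PROVED SUB-RUNG INSIDE the open rung `m = 2`: on a smooth projective
  fourfold whose `CH₀` is supported in dimension `≤ 3` (Bloch–Srinivas decomposition of the diagonal;
  Conte–Murre: uniruled / rationally connected fourfolds, quartic and quintic fourfolds), every rational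
  `(2,2)`-class is algebraic.  Stated here HYPOTHESIS-FED on the named fact
  `BlochSrinivas1983_hodgeConjectureDegreeFour_of_chowZeroSupported` (to keep this witness file on the light
  import cone of `DecompositionOfTheDiagonal.lean`); the tree DISCHARGES that fact —
  `BlochSrinivas1983_hodgeConjectureDegreeFour_of_chowZeroSupported_holds`
  (`Literature/Barriers/HodgeConjecture/DecompositionOfTheDiagonalDegreeFourHolds.lean`) — so the sub-rung is
  unconditional in the tree.  This is the `CH₀`-niveau sub-ladder `k ≤ 3` (proved) → `k = 4` (= all
  fourfolds = the rung), CAPPED by `not_hasChowZeroSupportedInDimLE_of_isOfHodgeType` (same file).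
* `rung_two_abelianFourfold_of_Markman` — calibration on the anchor side (hypothesis-fed: the named CLAIM
  `Markman2025_hodgeClasses_algebraic_abelian_dim_le_five`, arXiv:2509.23403 Cor. 1.3 / arXiv:2502.03415):
  the rung holds for abelian fourfolds.  (Excluded from the crux by its anchor hypothesis; recorded because
  it is the most recent movement on the rung.)

Regime note (F3, honest): the top is an EQUIVALENCE (`HodgeBeyondAnchors ↔ HodgeConjecture`), so every
proved rung is by definition a proved case of `S`; "outside S's known regime" is vacuous for this seed and
the witness is the highest proved rung `m = 1` (+ the proved interior of `m = 2`).
-/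

set_option linter.dupNamespace false

noncomputable section

open Literature.AlgebraicTopology.SingularHomology
open Literature.AlgebraicGeometry.Motives Literature.AlgebraicGeometry.HodgeTheory
open Literature.Barriers.HodgeConjecture

namespace Summit.HodgeConjecture.HodgeConjecture.Cruxes.HodgeBeyondAnchors.MiddleHodgeLadderSpecial

/-- Rung `m` (verbatim `Lines/MiddleHodgeLadder.lean: MiddleHodge`). [cite: BrosnanFangNiePearlstein2009, §6 Lemma 48] -/
def MiddleHodge (m : ℕ) : Prop :=
  ∀ ⦃X : SchemeOver ℂ⦄, IsSmoothProjective (2 * m) X →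
    ∀ c : complexBetti X (2 * m), IsRationalClass c → IsOfHodgeType (2 * m) X (2 * m) m m c →
      c ∈ algebraicClasses X m

/-- Rung `0`. [cite: VoisinHodgeI2002, §11.3] -/
theorem rung_zero : MiddleHodge 0 := by
  intro X _ c _ _
  rw [algebraicClasses_zero]
  exact Submodule.mem_top

/-- **WITNESS (θ₀ = 1)**: Lefschetz `(1,1)` on smooth projective surfaces. [cite: VoisinHodgeI2002, Thm. 11.30] -/
theorem rung_one : MiddleHodge 1 :=
  fun _X hX c hc h ↦ lefschetzOneOne_rational_holds hX c hc h

example : MiddleHodge 1 := rung_one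

/-- The floor in the dimension parameter: the Hodge conjecture for curves, surfaces, threefolds.
[cite: VoisinHodgeII2003, proof of Prop. 10.26] -/
theorem dims_le_three {n : ℕ} {X : SchemeOver ℂ} (hn : n ≤ 3) (hX : IsSmoothProjective n X) :
    HodgeConjectureFor n X :=
  hodgeConjectureFor_of_dim_le_three_holds hn hX

/-- **Proved interior of the OPEN rung `m = 2`** (the `CH₀`-niveau sub-ladder, `k ≤ 3`): fourfolds with
`CH₀` supported in dimension `≤ 3`. [cite: BlochSrinivas1983, Thm. 1 (3)] [cite: ConteMurre1978]
[cite: VoisinHodgeII2003, Prop. 10.26] -/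
theorem rung_two_of_chowZeroSupported
    (hBS : BlochSrinivas1983_hodgeConjectureDegreeFour_of_chowZeroSupported)
    ⦃X : SchemeOver ℂ⦄ (hX : IsSmoothProjective (2 * 2) X)
    (hW : HasChowZeroSupportedInDimLE X 3) (c : complexBetti X (2 * 2)) (hc : IsRationalClass c)
    (h22 : IsOfHodgeType (2 * 2) X (2 * 2) 2 2 c) : c ∈ algebraicClasses X 2 :=
  hBS hX hW c hc h22

/-- The rung restricted to `CH₀`-small fourfolds, in the rung's own shape (feed
`BlochSrinivas1983_hodgeConjectureDegreeFour_of_chowZeroSupported_holds`). -/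
example (hBS : BlochSrinivas1983_hodgeConjectureDegreeFour_of_chowZeroSupported) :
    ∀ ⦃X : SchemeOver ℂ⦄, IsSmoothProjective (2 * 2) X → HasChowZeroSupportedInDimLE X 3 →
    ∀ c : complexBetti X (2 * 2), IsRationalClass c → IsOfHodgeType (2 * 2) X (2 * 2) 2 2 c →
      c ∈ algebraicClasses X 2 :=
  fun _X hX hW c hc h22 ↦ rung_two_of_chowZeroSupported hBS hX hW c hc h22

/-- The CAP of the `CH₀` sub-ladder (Mumford / Bloch–Srinivas converse, tree theorem fed with the named
fact `BlochSrinivas1983_hodgeTypeL0_vanish_of_chowZeroSupported`): a fourfold carrying a non-zero class of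
type `(4,0)` is outside the Bloch–Srinivas regime, so the sub-ladder stops at `CH₀`-niveau `3`.
[cite: VoisinHodgeII2003, Thm. 10.4 and Prop. 10.26] -/
example (hM : BlochSrinivas1983_hodgeTypeL0_vanish_of_chowZeroSupported) ⦃X : SchemeOver ℂ⦄
    (hX : IsSmoothProjective 4 X) (c : complexBetti X 4) (hc : IsOfHodgeType 4 X 4 4 0 c) (hne : c ≠ 0) :
    ¬ HasChowZeroSupportedInDimLE X 3 :=
  not_hasChowZeroSupportedInDimLE_of_isOfHodgeType hM hX (by norm_num) hc hne

/-- Calibration on the anchor side (hypothesis-fed named CLAIM, under review): the rung on abelian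
fourfolds. [claim: Markman2025SurveySecant, status: under-review] -/
theorem rung_two_abelianFourfold_of_Markman (h : Markman2025_hodgeClasses_algebraic_abelian_dim_le_five)
    (A : AbelianVariety ℂ) (hA : A.dim = 4) (hX : IsSmoothProjective 4 A.X)
    (c : complexBetti A.X (2 * 2)) (hc : IsRationalClass c) (h22 : IsOfHodgeType 4 A.X (2 * 2) 2 2 c) :
    c ∈ algebraicClasses A.X 2 := by
  refine h A (by omega) ?_ 2 c hc ?_
  · rw [hA]; exact hX
  · rw [hA]; exact h22

end Summit.HodgeConjecture.HodgeConjecture.Cruxes.HodgeBeyondAnchors.MiddleHodgeLadderSpecial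

end
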